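import Literature.MathematicalPhysics.QuantumFieldTheory.Balaban1983to89.B9Thm31CoercivePrimeCompactZd

/-!
# `Balaban1983to89.B9Eq325QGGQCoerciveCompactZd` — [Balaban1985BackgroundPropagators] (3.25) p. 394 ∕ THM 3.11 p. 416 («the operators Δ′_a, G′, (Q′G′²Q′*)⁻¹ … are
# positive definite. This is obvious for the first three operators») IN QUANTITATIVE CURRENCY AT THE `ℤᵈ × 𝔸` CARRIER: ONE COERCIVITY CONSTANT
# `c″·⟨φ, φ⟩_τ ≤ ⟨φ, Q′G′(U₀)²Q′* φ⟩_τ` on `L²(𝔅, ·)` FOR EVERY UNITARY BACKGROUND IN THE CLOSED CLASS (1.7) ON `ℤᵈ` — compactness of that class (this seat's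
# `B9Thm31CoercivePrimeCompactZd`), g2's positivity `‖G′Q′*φ‖²_τ > 0` under «Q′ onto», and g3's continuity of `Q′G′²Q′*` in the background on the regime

statement-level skeleton of published theorems with citation tags; proofs where landed; nothing here is a claim about the
Yang–Mills mass gap

`[Balaban1985BackgroundPropagators]` ("B9", CMP **99** (1985) 389–434) p. 394 (3.25): *«R = G′Q′*(Q′G′²Q′*)⁻¹Q′G′ … These definitions make sense if Δ′_a, Q′G′²Q′*
are invertible. It will be proved later (Theorem 3.11)»*; p. 416, Theorem 3.11 (quoted in the companion files).  The NUMBER `c″ > 0` is the displayed `hco` of the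
SECOND station `c = (Q′G′²Q′*)⁻¹` of dag-n06-w2 g4's Combes–Thomas road at the `ℤᵈ` frame (their l.32561: «STATION 2 … not claimed»); this file supplies it, uniformly
over the compact closed small-field class, exactly as `B9Thm31CoercivePrimeCompactZd` does for `Δ′_a` (STATION 1).  PDF held:
`paper:balaban1985-cmp99-background-propagators` pp. 394, 416 (re-read by this seat, 2026-08-28).

CITATION HEADER (lean-in-tree rule).  Cell `pub-ymgap` (YM Track A, D-0062 ∕ D-0149), node N06 = [B9], width seat `pub-ymgap-dag-n06-w4` (g4), CLAIM-6 ∕ INTENT-6.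
Inputs BY NAME: this seat's g2 `B9Eq325QGGQInvZd` (`levSupp`, `levForm`, `qggq`, `levForm_qggq_self_nonneg ∕ _eq_zero`, `QprimeStarInjective`, `finiteDimensional_levSupp`),
g3 `B9Eq325ProjContinuityZd` (`continuousAt_qggq`, `continuousAt_levSupp_iff`), g3 `B9Thm311PosDefNearFlatZd.qprimeStarInjective_cubeMember` (dag-n05-c's «Q′ onto» at cube
members), g4 `B9Thm31CoercivePrimeCompactZd` (`continuousAt_bgT_of_reg17UnivP`, `isCompact_unitary_plaqClosed`, `plaqClosed_subset_reg17UnivP`, `one_mem_plaqClosed`), g4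
`B9Eq335UnitaryClassCompactZd.exists_coercive_of_isCompact`.

WHAT IS PROVED (kernel, 0 sorry; theorems only — no `def`, `instance`, `notation`; `𝔸` a finite-dimensional nontrivial C⋆-algebra, `τ` a PARAMETER).
* §1 ★ `levForm_qggq_self_pos` (`Q′*` injective at `U₀` ⟹ `0 < ⟨φ, Q′G′²Q′*φ⟩_τ` for `φ ≠ 0`; every unitary `U₀`, `a ≥ 0`).
* §2 `continuous_levForm_right` (the pairing is continuous in its second argument), ★ `continuous_levForm_qggq_subtype` (on the subtype of any `C ⊆ 𝒰′`, the entries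
  `U₀ ↦ ⟨ψ, Q′G′(U₀)²Q′*φ⟩_τ` are continuous — g3's `continuousAt_qggq` along `Subtype.val`, transporters by `continuousAt_bgT_of_reg17UnivP`).
* §3 ★★★ `exists_coercive_levForm_qggq_of_isCompact` — every COMPACT `C ⊆ 𝒰′` on which `Q′*` is injective: ONE `c″ > 0` with `c″·⟨φ,φ⟩_τ ≤ ⟨φ, Q′G′(U₀)²Q′*φ⟩_τ` for all
  `U₀ ∈ C`, all `φ ∈ L²(𝔅, ·)` (generic `s`, `m`, `a ≥ 0`, `Λ`); ★★★★ `exists_coercive_levForm_qggq_plaqClosed` (the closed class «unitary ∧ all plaquettes ≤ β»,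
  `β < (α_Q∕L²)L^{−2m}`); ★★★ `exists_coercive_levForm_qggq_plaqClosed_cubeMember` (at a cube member, `Λ_j = cubeLamS …`, `s = □₀`: «Q′ onto» discharged by name, NO
  displayed hypothesis left) · `coercive_levForm_qggq_one_cubeMember` (A6 at `U₀ = 1`).

HONEST SCOPE.  (i) `c″` is NON-QUANTITATIVE (compactness × finite dimension) and member∕data-dependent; print's constants are uniform — NOT claimed.  (ii) The class is the
closed (1.7)-class on ALL of `ℤᵈ` (window below `α_Q∕L²`).  (iii) No statement about `(Q′G′²Q′*)⁻¹`'s decay (that is STATION 2 proper).  (iv) `τ` is a PARAMETER; no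
instance.  (v) Count-neutral helper (`--supports` the K1 item of record); N05 ∕ N06 NOT discharged; K1 NOT closed; one finite `𝕋⁴` programme at fixed `ε`, Bałaban as
printed; R4 closes only the conditional finite-`𝕋⁴` rung `BalabanLadder.UV` — nothing continuum ∕ ℝ⁴ ∕ OS ∕ mass gap ∕ Clay.  Unit `pub-ymgap-dag-n06-w4` (g4), 2026-08-28.
-/

noncomputable section

namespace Literature.MathematicalPhysics.QuantumFieldTheory.Balaban1983to89.B9Eq325QGGQCoerciveCompactZd

open Filter Topology
open B7Prop1Explicit
open B7Prop2Explicit (unitaryUnits)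
open B8Ineq132 (plaqF)
open B8Eq119TwistedAxial (bgT)
open B8Eq131CubesAdmissible (cubeFam)
open B8CubeMemberZd (cubeLamS)
open B8LeafModelZd (ZdIdx)
open B8Eq191FlatLettersCubeMember (cubeLamS_finite)
open B9Eq316AveragingTransposeZd (Reg17 alphaQ alphaQ_pos tauForm tauForm_apply)
open B9Eq325QGGQInvZd (levSupp levForm levForm_apply qggq levForm_qggq_self_nonneg levForm_qggq_self_eq_zero QprimeStarInjective finiteDimensional_levSupp)
open B9Eq325ProjContinuityZd (continuousAt_qggq continuousAt_levSupp_iff)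
open B9Thm311PosDefOpenZd (continuous_tauForm_right cubeMember_Ω0_finite)
open B9Thm311PosDefNearFlatZd (qprimeStarInjective_cubeMember)
open B9Thm31CoercivePrimeCompactZd (continuousAt_bgT_of_reg17UnivP isCompact_unitary_plaqClosed plaqClosed_subset_reg17UnivP one_mem_plaqClosed)
open B9Eq335UnitaryClassCompactZd (exists_coercive_of_isCompact)

export B7Prop1Explicit (Site)

variable {d : ℕ} {𝔸 : Type*} [CStarAlgebra 𝔸] [FiniteDimensional ℝ 𝔸] [Nontrivial 𝔸]
variable (τ : 𝔸 →ₗ[ℂ] ℂ) (hτp : ∀ a : 𝔸, a ≠ 0 → 0 < (τ (star a * a)).re) {L : ℕ} {η : ℝ}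
  (hτt : ∀ a b : 𝔸, τ (a * b) = τ (b * a)) (hτs : ∀ a : 𝔸, τ (star a) = starRingEnd ℂ (τ a))

/-! ## §1  Positivity at one background -/

omit [Nontrivial 𝔸] in
/-- ★ **`⟨φ, Q′G′(U₀)²Q′*φ⟩_τ > 0` FOR `φ ≠ 0`** when `Q′*` is injective at `U₀` («Q′ onto»): g2's `= ‖G′Q′*φ‖²_τ ≥ 0` and `= 0 ⟹ φ = 0` combined (every unitary `U₀`,
`a ≥ 0`, `0 < d`, `η ≠ 0`). [cite: Balaban1985BackgroundPropagators, Thm 3.11 p.416 («(Q′G′²Q′*)⁻¹ … positive definite. This is obvious»), (3.25) p.394] -/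
theorem levForm_qggq_self_pos (hd : 0 < d) (hη : η ≠ 0) (m : ℕ) {a : ℕ → ℝ} (ha : ∀ j, 0 ≤ a j) (Λ : ℕ → Finset (Site d)) (s : Finset (Site d))
    {U₀ : Site d → Fin d → 𝔸ˣ} (hU : ∀ (x : Site d) (κ : Fin d), U₀ x κ ∈ unitaryUnits 𝔸) (hinj : QprimeStarInjective L U₀ τ hτp m Λ s)
    {φ : levSupp (𝔸 := 𝔸) m Λ} (hφ : φ ≠ 0) :
    0 < levForm τ m Λ φ (qggq L U₀ η τ hτp m a Λ s hd hη hτt hτs hU ha φ) := by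
  rcases (levForm_qggq_self_nonneg L U₀ η τ hτp m a Λ s hd hη hτt hτs hU ha φ).lt_or_eq with hlt | heq
  · exact hlt
  · exact absurd (levForm_qggq_self_eq_zero L U₀ η τ hτp m a Λ s hd hη hτt hτs hU ha hinj heq.symm) hφ

/-! ## §2  Continuity of the entries along the regime -/

omit [Nontrivial 𝔸] in
/-- the level pairing is continuous in its second argument (a finite sum of coordinates of `L²(𝔅, ·)`).
[cite: Balaban1985BackgroundPropagators, (3.24) p.394 (bookkeeping)] -/
theorem continuous_levForm_right (m : ℕ) (Λ : ℕ → Finset (Site d)) (ψ : levSupp (𝔸 := 𝔸) m Λ) :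
    Continuous fun φ : levSupp (𝔸 := 𝔸) m Λ => levForm τ m Λ ψ φ := by
  simp only [levForm_apply]
  refine continuous_finsetSum _ fun j _ => continuous_finsetSum _ fun y _ => ?_
  have hc : Continuous fun φ : levSupp (𝔸 := 𝔸) m Λ => (φ : ℕ × Site d → 𝔸) (j, y) :=
    (continuous_apply (j, y)).comp continuous_subtype_val
  have h := (continuous_tauForm_right τ ((ψ : ℕ × Site d → 𝔸) (j, y))).comp hc
  simpa only [Function.comp_def, tauForm_apply] using h

/-- ★ **ALONG ANY SUBSET OF THE REGIME, THE ENTRIES `U₀ ↦ ⟨ψ, Q′G′(U₀)²Q′*φ⟩_τ` ARE CONTINUOUS** (on the subtype of `C ⊆ 𝒰′`, product topology): g3's `continuousAt_qggq`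
along `Subtype.val`, the averaged transporters being continuous at every point of `𝒰′`. [cite: Balaban1985BackgroundPropagators, (3.25) p.394; Balaban1985RegularSpaces, (1.7) p.77] -/
theorem continuous_levForm_qggq_subtype (hd : 0 < d) (hL : 2 ≤ L) (hη : η ≠ 0) (m : ℕ) {a : ℕ → ℝ} (ha : ∀ j, 0 ≤ a j)
    (Λ : ℕ → Finset (Site d)) (s : Finset (Site d)) {C : Set (Site d → Fin d → 𝔸ˣ)}
    (hC : C ⊆ {U₀ : Site d → Fin d → 𝔸ˣ | (∀ x κ, U₀ x κ ∈ unitaryUnits 𝔸) ∧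
        Reg17 L m (fun _ => (Set.univ : Set (Site d))) (alphaQ d L / (L : ℝ) ^ 2) U₀}) (ψ φ : levSupp (𝔸 := 𝔸) m Λ) :
    Continuous fun z : C => levForm τ m Λ ψ (qggq L (z : Site d → Fin d → 𝔸ˣ) η τ hτp m a Λ s hd hη hτt hτs (hC z.2).1 ha φ) := by
  refine continuous_iff_continuousAt.2 fun z₀ => ?_
  have hU : ContinuousAt (fun z : C => (z : Site d → Fin d → 𝔸ˣ)) z₀ := continuous_subtype_val.continuousAt
  have hbgT : ∀ j, j < m + 1 → ∀ (y x : Site d), ContinuousAt (fun z : C => bgT L (z : Site d → Fin d → 𝔸ˣ) j y x) z₀ :=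
    fun j hj y x => (continuousAt_bgT_of_reg17UnivP hd hL m (hC z₀.2).1 (hC z₀.2).2 j hj y x).comp hU
  have hq := continuousAt_qggq (hU := hU) (τ := τ) (hτp := hτp) (L := L) (η := η) (m := m) (a := a) (Λ := Λ) (s := s) (hbgT := hbgT)
    (hd := hd) (hη := hη) (hτt := hτt) (hτs := hτs) (hUu := fun z => (hC z.2).1) (ha := ha) (Φ := fun _ => φ) continuousAt_const
  exact (continuous_levForm_right τ m Λ ψ).continuousAt.comp hq

/-! ## §3  ONE coercivity constant for `Q′G′²Q′*` over a compact class -/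

/-- ★★★ **THEOREM 3.11, THIRD OPERATOR, IN QUANTITATIVE CURRENCY OVER A COMPACT CLASS OF REGIME BACKGROUNDS**: for every COMPACT `C ⊆ 𝒰′` (product topology) on
which `Q′*` is injective there is ONE `c″ > 0` with `c″·⟨φ, φ⟩_τ ≤ ⟨φ, Q′G′(U₀)²Q′*φ⟩_τ` for ALL `U₀ ∈ C` and all `φ ∈ L²(𝔅, ·)` — generic `Ω₀ = s`, `m`, `a ≥ 0`, `Λ`;
`0 < d`, `2 ≤ L`, `η ≠ 0` (the engine on the subtype `C`, which is a compact space). [cite: Balaban1985BackgroundPropagators, Thm 3.11 p.416, (3.25) p.394; Balaban1984PropagatorsII, p.226] -/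
theorem exists_coercive_levForm_qggq_of_isCompact (hd : 0 < d) (hL : 2 ≤ L) (hη : η ≠ 0) (m : ℕ) {a : ℕ → ℝ} (ha : ∀ j, 0 ≤ a j)
    (Λ : ℕ → Finset (Site d)) (s : Finset (Site d)) {C : Set (Site d → Fin d → 𝔸ˣ)} (hCc : IsCompact C)
    (hC : C ⊆ {U₀ : Site d → Fin d → 𝔸ˣ | (∀ x κ, U₀ x κ ∈ unitaryUnits 𝔸) ∧
        Reg17 L m (fun _ => (Set.univ : Set (Site d))) (alphaQ d L / (L : ℝ) ^ 2) U₀})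
    (hinj : ∀ U₀ ∈ C, QprimeStarInjective L U₀ τ hτp m Λ s) :
    ∃ c : ℝ, 0 < c ∧ ∀ (U₀ : Site d → Fin d → 𝔸ˣ) (hU₀ : U₀ ∈ C) (φ : levSupp (𝔸 := 𝔸) m Λ),
      c * levForm τ m Λ φ φ ≤ levForm τ m Λ φ (qggq L U₀ η τ hτp m a Λ s hd hη hτt hτs (hC hU₀).1 ha φ) := by
  haveI := finiteDimensional_levSupp (𝔸 := 𝔸) m Λ
  let q : C → levSupp (𝔸 := 𝔸) m Λ →ₗ[ℝ] levSupp (𝔸 := 𝔸) m Λ →ₗ[ℝ] ℝ :=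
    fun z => (levForm τ m Λ).compl₂ (qggq L (z : Site d → Fin d → 𝔸ˣ) η τ hτp m a Λ s hd hη hτt hτs (hC z.2).1 ha)
  have hq : ∀ (z : C) (ψ φ : levSupp (𝔸 := 𝔸) m Λ),
      q z ψ φ = levForm τ m Λ ψ (qggq L (z : Site d → Fin d → 𝔸ˣ) η τ hτp m a Λ s hd hη hτt hτs (hC z.2).1 ha φ) :=
    fun z ψ φ => LinearMap.compl₂_apply _ _ _ _
  have hK : IsCompact (Set.univ : Set C) := isCompact_iff_isCompact_univ.1 hCc
  have hcont : ∀ ψ φ : levSupp (𝔸 := 𝔸) m Λ, ContinuousOn (fun z => q z ψ φ) Set.univ := by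
    intro ψ φ
    have h := continuous_levForm_qggq_subtype τ hτp hτt hτs hd hL hη m ha Λ s hC ψ φ
    simpa only [hq] using h.continuousOn
  have hpos : ∀ z ∈ (Set.univ : Set C), ∀ φ : levSupp (𝔸 := 𝔸) m Λ, φ ≠ 0 → 0 < q z φ φ := by
    intro z _ φ hφ
    rw [hq]
    exact levForm_qggq_self_pos τ hτp hτt hτs hd hη m ha Λ s (hC z.2).1 (hinj z z.2) hφ
  obtain ⟨c, hc, hcoer⟩ := exists_coercive_of_isCompact q (levForm τ m Λ) hK hcont hpos
  refine ⟨c, hc, fun U₀ hU₀ φ => ?_⟩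
  have h := hcoer ⟨U₀, hU₀⟩ (Set.mem_univ _) φ
  rwa [hq] at h

/-- ★★★★ **ONE COERCIVITY CONSTANT FOR `Q′G′(U₀)²Q′*` OVER THE WHOLE CLOSED CLASS (1.7) ON `ℤᵈ`**: for every `β < (α_Q∕L²)·L^{−2m}` and data on which `Q′*` is injective at
every unitary background, there is `c″ > 0` such that for EVERY unitary `U₀` with `‖U₀(∂p) − 1‖ ≤ β` at every plaquette of `ℤᵈ` and every `φ ∈ L²(𝔅, ·)`:
`c″·⟨φ, φ⟩_τ ≤ ⟨φ, Q′G′(U₀)²Q′*φ⟩_τ`. [cite: Balaban1985BackgroundPropagators, Thm 3.11 p.416, (3.25) p.394, (3.35) p.396; Balaban1985RegularSpaces, (1.7) p.77] -/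
theorem exists_coercive_levForm_qggq_plaqClosed (hd : 0 < d) (hL : 2 ≤ L) (hη : η ≠ 0) (m : ℕ) {a : ℕ → ℝ} (ha : ∀ j, 0 ≤ a j)
    (Λ : ℕ → Finset (Site d)) (s : Finset (Site d)) {β : ℝ} (hβ : β < alphaQ d L / (L : ℝ) ^ 2 * (((L : ℝ) ^ m)⁻¹) ^ 2)
    (hinj : ∀ U₀ : Site d → Fin d → 𝔸ˣ, (∀ x κ, U₀ x κ ∈ unitaryUnits 𝔸) → QprimeStarInjective L U₀ τ hτp m Λ s) :
    ∃ c : ℝ, 0 < c ∧ ∀ (U₀ : Site d → Fin d → 𝔸ˣ) (hU₀ : ∀ x κ, U₀ x κ ∈ unitaryUnits 𝔸),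
      (∀ (x : Site d) (μ ν : Fin d), ‖plaqF U₀ μ ν x - 1‖ ≤ β) →
        ∀ φ : levSupp (𝔸 := 𝔸) m Λ, c * levForm τ m Λ φ φ ≤ levForm τ m Λ φ (qggq L U₀ η τ hτp m a Λ s hd hη hτt hτs hU₀ ha φ) := by
  have hL1 : 1 ≤ L := le_trans one_le_two hL
  obtain ⟨c, hc, h⟩ := exists_coercive_levForm_qggq_of_isCompact τ hτp hτt hτs hd hL hη m ha Λ s
    (isCompact_unitary_plaqClosed (𝔸 := 𝔸) β) (plaqClosed_subset_reg17UnivP hL1 m hβ) (fun U₀ hU₀ => hinj U₀ hU₀.1)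
  exact ⟨c, hc, fun U₀ hU₀ hplaq φ => h U₀ ⟨hU₀, hplaq⟩ φ⟩

/-- ★★★ **AT A CUBE MEMBER NO HYPOTHESIS IS LEFT**: with `Λ_j` the level-`j` constraint sites of the cube member (`cubeLamS`, [Balaban1985RegularSpaces] (1.131)) and `s = □₀`,
«Q′ onto» holds at every background (dag-n05-c ∕ g3's `qprimeStarInjective_cubeMember`), so for every `β < (α_Q∕L²)·L^{−2m}`: ONE `c″ > 0` for EVERY unitary `U₀` in the
closed class. [cite: Balaban1985BackgroundPropagators, Thm 3.11 p.416, (3.25) p.394, (3.18)–(3.19) p.393; Balaban1985RegularSpaces, (1.7) p.77, (1.131) p.99] -/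
theorem exists_coercive_levForm_qggq_plaqClosed_cubeMember [NeZero L] (hd : 0 < d) (hL : 2 ≤ L) {a₀ : ℕ → ℝ} (ha : ∀ j, 0 ≤ a₀ j)
    (i : ZdIdx d L) (hη : i.η ≠ 0) {a : Site d} {Mc ρ : ℕ} (hΩ : i.Ω = cubeFam false L a Mc ρ i.k) (hρ : L ≤ ρ) {m : ℕ} (hm : m ≤ i.k)
    {β : ℝ} (hβ : β < alphaQ d L / (L : ℝ) ^ 2 * (((L : ℝ) ^ m)⁻¹) ^ 2) :
    ∃ c : ℝ, 0 < c ∧ ∀ (U₀ : Site d → Fin d → 𝔸ˣ) (hU₀ : ∀ x κ, U₀ x κ ∈ unitaryUnits 𝔸),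
      (∀ (x : Site d) (μ ν : Fin d), ‖plaqF U₀ μ ν x - 1‖ ≤ β) →
        ∀ φ : levSupp (𝔸 := 𝔸) m (fun j => (cubeLamS_finite L a Mc ρ i.k m j).toFinset),
          c * levForm τ m (fun j => (cubeLamS_finite L a Mc ρ i.k m j).toFinset) φ φ ≤
            levForm τ m (fun j => (cubeLamS_finite L a Mc ρ i.k m j).toFinset) φ
              (qggq L U₀ i.η τ hτp m a₀ (fun j => (cubeLamS_finite L a Mc ρ i.k m j).toFinset) (cubeMember_Ω0_finite i hΩ).toFinset
                hd hη hτt hτs hU₀ ha φ) :=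
  exists_coercive_levForm_qggq_plaqClosed τ hτp hτt hτs hd hL hη m ha _ _ hβ
    fun U₀ _ => qprimeStarInjective_cubeMember τ hτp hτs i hΩ hρ hm U₀

/-- **A6 ∕ NON-VACUITY AT THE CUBE MEMBER**: the window is positive, `β = 0` is admissible, the flat background is in the class, and the bound holds at `U₀ = 1`.
[cite: Balaban1985BackgroundPropagators, Thm 3.11 p.416; Balaban1985RegularSpaces, (1.7) p.77] -/
theorem coercive_levForm_qggq_one_cubeMember [NeZero L] (hd : 0 < d) (hL : 2 ≤ L) {a₀ : ℕ → ℝ} (ha : ∀ j, 0 ≤ a₀ j)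
    (i : ZdIdx d L) (hη : i.η ≠ 0) {a : Site d} {Mc ρ : ℕ} (hΩ : i.Ω = cubeFam false L a Mc ρ i.k) (hρ : L ≤ ρ) {m : ℕ} (hm : m ≤ i.k)
    (h1 : ∀ (x : Site d) (κ : Fin d), (1 : Site d → Fin d → 𝔸ˣ) x κ ∈ unitaryUnits 𝔸) :
    ∃ c : ℝ, 0 < c ∧ ∀ φ : levSupp (𝔸 := 𝔸) m (fun j => (cubeLamS_finite L a Mc ρ i.k m j).toFinset),
      c * levForm τ m (fun j => (cubeLamS_finite L a Mc ρ i.k m j).toFinset) φ φ ≤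
        levForm τ m (fun j => (cubeLamS_finite L a Mc ρ i.k m j).toFinset) φ
          (qggq L (1 : Site d → Fin d → 𝔸ˣ) i.η τ hτp m a₀ (fun j => (cubeLamS_finite L a Mc ρ i.k m j).toFinset)
            (cubeMember_Ω0_finite i hΩ).toFinset hd hη hτt hτs h1 ha φ) := by
  have hL1 : 1 ≤ L := le_trans one_le_two hL
  have hL0 : (0 : ℝ) < L := by exact_mod_cast (lt_of_lt_of_le zero_lt_one hL1)
  have hw : (0 : ℝ) < alphaQ d L / (L : ℝ) ^ 2 * (((L : ℝ) ^ m)⁻¹) ^ 2 := by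
    have := alphaQ_pos d hL1
    positivity
  obtain ⟨c, hc, h⟩ := exists_coercive_levForm_qggq_plaqClosed_cubeMember τ hτp hτt hτs hd hL ha i hη hΩ hρ hm (β := 0) hw
  exact ⟨c, hc, fun φ => h 1 h1 (one_mem_plaqClosed (d := d) (𝔸 := 𝔸) (β := 0) le_rfl).2 φ⟩

end Literature.MathematicalPhysics.QuantumFieldTheory.Balaban1983to89.B9Eq325QGGQCoerciveCompactZd

end
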